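import Mathlib
import HarnessLib
import Summits.HubbardSuperconductivity.HubbardSuperconductivity.Theorems.KLProgrammeKLRegimeSymbolSampledCrude

/-!
# Route `KLProgramme` — VL child `KLRegimeVolumeLimitV17F2` (stmt-HubbardSuperconductivity-20440), closer MODEL file M2 «MISMATCH-SLICE», bracket (c),
# part 2c: pointwise second differences (time, any integer spatial step) of the sampled DERIVED multiplier symbol
# `H(k₀² + e(p)²)·(2e(p)v(p))·Z(p)` — the `t`-derivative of the interpolated family of part 2a — from sup data of `e, v, Z`

Cell `gate-hubbard-kl`, seat hubbard-kl-k3c4-p2 (g11; UV / Matsubara all-U lane), ask «MISMATCH-SLICE» (= M2, bracket (c)) of the VL registrant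
k3c4-p1 g11.  By `…SymbolIncrementLine.norm_fwdDiff_iter_symbolIncrement_le` the sampled DIFFERENCE of a multiplier symbol `G(k₀² + e²)·Z` between
two bands `e₀, e₁` is controlled by the derived family `H(k₀² + e_t²)·(2e_t v)·Z`, `H = G′`, `e_t = e₀ + t v`, `v = e₁ − e₀`.  Here, for a
generic `C²` profile `H` (`|H| ≤ h₀`, `|H′| ≤ h₁/Λ²`, `|H″| ≤ h₂/Λ⁴`, `H = 0` above `Λ²`), a `C²` band `e` (`|e| ≤ E₀`, `‖De‖ ≤ K₁`, `‖D²e‖ ≤ K₂`),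
a `C²` increment `v` (`|v| ≤ P₀`, `‖Dv‖ ≤ P₁`, `‖D²v‖ ≤ P₂`) and a `C²` factor `Z` (`|Z| ≤ z₀`, `‖DZ‖ ≤ z₁`, `‖D²Z‖ ≤ z₂`):

* §1 **`abs_tripleLine_bounds`** — the line factor `s ↦ 2e(k+s•w)v(k+s•w)Z(k+s•w)` has
  value `≤ ω₀`, first derivative `≤ ω₁‖w‖`, second `≤ ω₂‖w‖²` with
  `ω₀ = 2E₀P₀z₀`, `ω₁ = 2((K₁P₀ + E₀P₁)z₀ + E₀P₀z₁)`, `ω₂ = 2((K₂P₀ + 2K₁P₁ + E₀P₂)z₀ + 2(K₁P₀ + E₀P₁)z₁ + E₀P₀z₂)` — EVERY term carries one of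
  `P₀, P₁, P₂`;
* §2 **`norm_fwdDiff_two_space_derivedSymbol_le`** — for an integer step `u` (`w = hₓu`) under the zone condition:
  `‖Δ²_{(0,ū)} G̃′(q)‖ ≤ ‖w‖²·( ((4h₂+2h₁)K₁²/Λ² + 2h₁K₂/Λ)·ω₀ + 4h₁K₁/Λ·ω₁ + h₀·ω₂ )` for every `q`;
* §3 **`norm_fwdDiff_two_time_derivedSymbol_le`** — under the frequency window: `‖Δ²_{(1,0)} G̃′(q)‖ ≤ (4h₂+2h₁)h₀′²ω₀/Λ²` (`h₀′` the frequency step;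
  p4's `norm_fwdDiff_two_time_sampledSymbol_le` with the factor's sup `ω₀`).

Everything is proved; no definitions, no named facts; nothing about the model is asserted. [folklore]
-/

noncomputable section

namespace Summit.HubbardSuperconductivity.HubbardSuperconductivity.Theorems.TorusFourierL2

set_option linter.dupNamespace false -- summit = problem name (single-conjunct summit), D-0017

open Set Finset Filter Topology Literature.Probability.LatticeModels Literature.Analysis.Calculus
open scoped Real

/-! ## §1 The derived line factor `2·e·v·Z` along a spatial line -/

section Factor

variable {V : Type*} [NormedAddCommGroup V] [NormedSpace ℝ V]

/-- **The derived line factor and its first two derivatives** (`W(s) = 2·e(k+s•w)·v(k+s•w)·Z(k+s•w)`): with the sup data of the module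
docstring, `|W(s)| ≤ ω₀`, `|W′(s)| ≤ ω₁‖w‖`, `|W″(s)| ≤ ω₂‖w‖²`. [folklore] -/
theorem abs_tripleLine_bounds {e v Z : V → ℝ} (he : ContDiff ℝ 2 e) (hv : ContDiff ℝ 2 v) (hZ : ContDiff ℝ 2 Z)
    {E₀ K₁ K₂ P₀ P₁ P₂ z₀ z₁ z₂ : ℝ} (hE₀ : ∀ p, |e p| ≤ E₀) (hK₁ : ∀ p, ‖fderiv ℝ e p‖ ≤ K₁) (hK₂ : ∀ p, ‖iteratedFDeriv ℝ 2 e p‖ ≤ K₂)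
    (hP₀ : ∀ p, |v p| ≤ P₀) (hP₁ : ∀ p, ‖fderiv ℝ v p‖ ≤ P₁) (hP₂ : ∀ p, ‖iteratedFDeriv ℝ 2 v p‖ ≤ P₂)
    (hz₀ : ∀ p, |Z p| ≤ z₀) (hz₁ : ∀ p, ‖fderiv ℝ Z p‖ ≤ z₁) (hz₂ : ∀ p, ‖iteratedFDeriv ℝ 2 Z p‖ ≤ z₂) (k w : V) (s : ℝ) :
    |(fun s : ℝ => 2 * e (k + s • w) * v (k + s • w) * Z (k + s • w)) s| ≤ 2 * E₀ * P₀ * z₀ ∧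
    |deriv (fun s : ℝ => 2 * e (k + s • w) * v (k + s • w) * Z (k + s • w)) s| ≤
      2 * ((K₁ * P₀ + E₀ * P₁) * z₀ + E₀ * P₀ * z₁) * ‖w‖ ∧
    |iteratedDeriv 2 (fun s : ℝ => 2 * e (k + s • w) * v (k + s • w) * Z (k + s • w)) s| ≤
      2 * ((K₂ * P₀ + 2 * K₁ * P₁ + E₀ * P₂) * z₀ + 2 * (K₁ * P₀ + E₀ * P₁) * z₁ + E₀ * P₀ * z₂) * ‖w‖ ^ 2 := by
  -- the three line functions and their data
  set a : ℝ → ℝ := fun s => e (k + s • w) with ha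
  set b : ℝ → ℝ := fun s => v (k + s • w) with hb
  set c : ℝ → ℝ := fun s => Z (k + s • w) with hc
  have haC : ContDiff ℝ 2 a := contDiff_two_line he k w
  have hbC : ContDiff ℝ 2 b := contDiff_two_line hv k w
  have hcC : ContDiff ℝ 2 c := contDiff_two_line hZ k w
  have hA0 : |a s| ≤ E₀ := hE₀ _
  have hA1 : |deriv a s| ≤ K₁ * ‖w‖ := abs_deriv_line_factor_le he hK₁ k w s
  have hA2 : |iteratedDeriv 2 a s| ≤ K₂ * ‖w‖ ^ 2 := abs_iteratedDeriv_two_line_le he hK₂ k w s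
  have hB0 : |b s| ≤ P₀ := hP₀ _
  have hB1 : |deriv b s| ≤ P₁ * ‖w‖ := abs_deriv_line_factor_le hv hP₁ k w s
  have hB2 : |iteratedDeriv 2 b s| ≤ P₂ * ‖w‖ ^ 2 := abs_iteratedDeriv_two_line_le hv hP₂ k w s
  have hC0 : |c s| ≤ z₀ := hz₀ _
  have hC1 : |deriv c s| ≤ z₁ * ‖w‖ := abs_deriv_line_factor_le hZ hz₁ k w s
  have hC2 : |iteratedDeriv 2 c s| ≤ z₂ * ‖w‖ ^ 2 := abs_iteratedDeriv_two_line_le hZ hz₂ k w s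
  have hE0 : 0 ≤ E₀ := (abs_nonneg _).trans hA0
  have hP0 : 0 ≤ P₀ := (abs_nonneg _).trans hB0
  have hz0 : 0 ≤ z₀ := (abs_nonneg _).trans hC0
  have hK10 : 0 ≤ K₁ := le_trans (norm_nonneg _) (hK₁ k)
  have hP10 : 0 ≤ P₁ := le_trans (norm_nonneg _) (hP₁ k)
  have hz10 : 0 ≤ z₁ := le_trans (norm_nonneg _) (hz₁ k)
  have hw0 : 0 ≤ ‖w‖ := norm_nonneg _
  have hK20 : 0 ≤ K₂ := le_trans (norm_nonneg _) (hK₂ k)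
  have hK2w : 0 ≤ K₂ * ‖w‖ ^ 2 := mul_nonneg hK20 (by positivity)
  -- the pair `ab = 2·a·b` and the triple `W = ab·c`
  set ab : ℝ → ℝ := fun s => 2 * a s * b s with hab
  have habC : ContDiff ℝ 2 ab := (contDiff_const.mul haC).mul hbC
  have hab_eq : ab = fun s => (fun s => 2 * a s) s * b s := rfl
  have h2aC : ContDiff ℝ 2 (fun s => 2 * a s) := contDiff_const.mul haC
  have hd2a : ∀ s, deriv (fun s => 2 * a s) s = 2 * deriv a s := fun s => by
    rw [deriv_const_mul 2 ((haC.differentiable (by norm_num)) s)]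
  have hdd2a : ∀ s, iteratedDeriv 2 (fun s => 2 * a s) s = 2 * iteratedDeriv 2 a s := fun s => by
    rw [iteratedDeriv_const_mul 2 haC.contDiffAt]
  have hab1 : deriv ab s = 2 * deriv a s * b s + 2 * a s * deriv b s := by
    rw [hab_eq, deriv_mul₂ h2aC hbC s, hd2a]
  have hab2 : iteratedDeriv 2 ab s = 2 * iteratedDeriv 2 a s * b s + 2 * (2 * deriv a s * deriv b s) + 2 * a s * iteratedDeriv 2 b s := by
    rw [hab_eq, iteratedDeriv_two_mul₂ h2aC hbC s, hd2a, hdd2a]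
  have hW_eq : (fun s : ℝ => 2 * e (k + s • w) * v (k + s • w) * Z (k + s • w)) = fun s => ab s * c s := rfl
  -- bounds of the pair
  have habs0 : |ab s| ≤ 2 * E₀ * P₀ := by
    simp only [hab]; rw [abs_mul, abs_mul, abs_two]; gcongr
  have habs1 : |deriv ab s| ≤ 2 * (K₁ * P₀ + E₀ * P₁) * ‖w‖ := by
    rw [hab1]
    calc _ ≤ |2 * deriv a s * b s| + |2 * a s * deriv b s| := abs_add_le _ _
      _ = 2 * (|deriv a s| * |b s|) + 2 * (|a s| * |deriv b s|) := by
          rw [abs_mul, abs_mul, abs_mul, abs_mul, abs_two]; ring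
      _ ≤ 2 * (K₁ * ‖w‖ * P₀) + 2 * (E₀ * (P₁ * ‖w‖)) := by gcongr
      _ = _ := by ring
  have habs2 : |iteratedDeriv 2 ab s| ≤ 2 * (K₂ * P₀ + 2 * K₁ * P₁ + E₀ * P₂) * ‖w‖ ^ 2 := by
    rw [hab2]
    calc _ ≤ |2 * iteratedDeriv 2 a s * b s + 2 * (2 * deriv a s * deriv b s)| + |2 * a s * iteratedDeriv 2 b s| := abs_add_le _ _
      _ ≤ |2 * iteratedDeriv 2 a s * b s| + |2 * (2 * deriv a s * deriv b s)| + |2 * a s * iteratedDeriv 2 b s| := by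
          gcongr; exact abs_add_le _ _
      _ = 2 * (|iteratedDeriv 2 a s| * |b s|) + 4 * (|deriv a s| * |deriv b s|) + 2 * (|a s| * |iteratedDeriv 2 b s|) := by
          rw [abs_mul, abs_mul, abs_mul, abs_mul, abs_mul, abs_mul, abs_mul, abs_two]; ring
      _ ≤ 2 * (K₂ * ‖w‖ ^ 2 * P₀) + 4 * (K₁ * ‖w‖ * (P₁ * ‖w‖)) + 2 * (E₀ * (P₂ * ‖w‖ ^ 2)) := by gcongr
      _ = _ := by ring
  have hab0' : 0 ≤ 2 * E₀ * P₀ := by positivity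
  have hP20 : 0 ≤ P₂ := le_trans (norm_nonneg _) (hP₂ k)
  have hab1' : 0 ≤ 2 * (K₁ * P₀ + E₀ * P₁) * ‖w‖ := by positivity
  have hab2' : 0 ≤ 2 * (K₂ * P₀ + 2 * K₁ * P₁ + E₀ * P₂) * ‖w‖ ^ 2 := by positivity
  refine ⟨?_, ?_, ?_⟩
  · -- value
    show |ab s * c s| ≤ 2 * E₀ * P₀ * z₀
    rw [abs_mul]
    exact mul_le_mul habs0 hC0 (abs_nonneg _) hab0'
  · -- first derivative
    rw [hW_eq, deriv_mul₂ habC hcC s]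
    calc _ ≤ |deriv ab s * c s| + |ab s * deriv c s| := abs_add_le _ _
      _ = |deriv ab s| * |c s| + |ab s| * |deriv c s| := by rw [abs_mul, abs_mul]
      _ ≤ 2 * (K₁ * P₀ + E₀ * P₁) * ‖w‖ * z₀ + 2 * E₀ * P₀ * (z₁ * ‖w‖) := by
          gcongr
      _ = _ := by ring
  · -- second derivative
    rw [hW_eq, iteratedDeriv_two_mul₂ habC hcC s]
    calc _ ≤ |iteratedDeriv 2 ab s * c s + 2 * (deriv ab s * deriv c s)| + |ab s * iteratedDeriv 2 c s| := abs_add_le _ _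
      _ ≤ |iteratedDeriv 2 ab s * c s| + |2 * (deriv ab s * deriv c s)| + |ab s * iteratedDeriv 2 c s| := by
          gcongr; exact abs_add_le _ _
      _ = |iteratedDeriv 2 ab s| * |c s| + 2 * (|deriv ab s| * |deriv c s|) + |ab s| * |iteratedDeriv 2 c s| := by
          rw [abs_mul, abs_mul, abs_mul, abs_mul, abs_two]
      _ ≤ 2 * (K₂ * P₀ + 2 * K₁ * P₁ + E₀ * P₂) * ‖w‖ ^ 2 * z₀ + 2 * (2 * (K₁ * P₀ + E₀ * P₁) * ‖w‖ * (z₁ * ‖w‖)) +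
          2 * E₀ * P₀ * (z₂ * ‖w‖ ^ 2) := by
          gcongr
      _ = _ := by ring

end Factor

/-! ## §2 Space second differences of the sampled derived symbol -/

section Sampled

variable {P L : ℕ} [NeZero P] [NeZero L]

/-- **Space direction, derived symbol**: for a `C²` profile `H` (`|H| ≤ h₀`, `|H′| ≤ h₁/Λ²`, `|H″| ≤ h₂/Λ⁴`, `H = 0` above `Λ²`), the symbol
`Φ′(k₀, p) = H(k₀² + e(p)²)·(2e(p)v(p))·Z(p)` sampled on the product torus, an integer step `u` (`w = hₓu`) and the zone condition:
`‖Δ²_{(0,ū)} G̃′(q)‖ ≤ ‖w‖²·( ((4h₂+2h₁)K₁²/Λ² + 2h₁K₂/Λ)·ω₀ + 4h₁K₁/Λ·ω₁ + h₀·ω₂ )` for EVERY `q` (`ω`'s as in §1).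
[cite: BenfattoGiulianiMastropietro2006, §2.5 Lemma 2.2 (2.53)–(2.55)] -/
theorem norm_fwdDiff_two_space_derivedSymbol_le {H : ℝ → ℝ} (hH : ContDiff ℝ 2 H) {Λ h₀ h₁ h₂ : ℝ} (hΛ : 0 < Λ)
    (hh₁ : 0 ≤ h₁) (hh₂ : 0 ≤ h₂) (hH0 : ∀ u, |H u| ≤ h₀) (hH1 : ∀ u, |deriv H u| ≤ h₁ / Λ ^ 2)
    (hH2 : ∀ u, |iteratedDeriv 2 H u| ≤ h₂ / Λ ^ 4) (hHv : ∀ u, Λ ^ 2 < u → H u = 0)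
    {e v Z : (Fin 2 → ℝ) → ℝ} (he : ContDiff ℝ 2 e) (hv : ContDiff ℝ 2 v) (hZ : ContDiff ℝ 2 Z)
    {E₀ K₁ K₂ P₀ P₁ P₂ z₀ z₁ z₂ : ℝ} (hE₀ : ∀ p, |e p| ≤ E₀) (hK₁ : ∀ p, ‖fderiv ℝ e p‖ ≤ K₁) (hK₂ : ∀ p, ‖iteratedFDeriv ℝ 2 e p‖ ≤ K₂)
    (hP₀ : ∀ p, |v p| ≤ P₀) (hP₁ : ∀ p, ‖fderiv ℝ v p‖ ≤ P₁) (hP₂ : ∀ p, ‖iteratedFDeriv ℝ 2 v p‖ ≤ P₂)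
    (hz₀ : ∀ p, |Z p| ≤ z₀) (hz₁ : ∀ p, ‖fderiv ℝ Z p‖ ≤ z₁) (hz₂ : ∀ p, ‖iteratedFDeriv ℝ 2 Z p‖ ≤ z₂)
    (Φ : ℝ × (Fin 2 → ℝ) → ℂ) (hΦ : ∀ k₀ p, Φ (k₀, p) = ((H (k₀ ^ 2 + e p ^ 2) * (2 * e p * v p) * Z p : ℝ) : ℂ)) (a₀ hf hx : ℝ)
    (u : Fin 2 → ℤ)
    (hzone : ∀ (k₀ : ℝ) (m : Fin 2 → ℤ), (∃ j, (L : ℤ) ≤ 2 * |m j| + 2 * (2 : ℕ) * |u j|) → Φ (k₀, fun j => hx * (m j : ℝ)) = 0)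
    (Gs : TorusSite 1 P × TorusSite 2 L → ℂ)
    (hGs : ∀ q, Gs q = Φ (a₀ + hf * (((q.1 0).val : ℕ) : ℝ), fun j => hx * (((q.2 j).valMinAbs : ℤ) : ℝ)))
    (q : TorusSite 1 P × TorusSite 2 L) :
    ‖((fwdDiff ((0 : TorusSite 1 P), (fun j => ((u j : ℤ) : ZMod L))))^[2] Gs) q‖ ≤
      ‖(fun j => hx * (u j : ℝ))‖ ^ 2 *
        (((4 * h₂ + 2 * h₁) * K₁ ^ 2 / Λ ^ 2 + 2 * h₁ * K₂ / Λ) * (2 * E₀ * P₀ * z₀) +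
          4 * h₁ * K₁ / Λ * (2 * ((K₁ * P₀ + E₀ * P₁) * z₀ + E₀ * P₀ * z₁)) +
          h₀ * (2 * ((K₂ * P₀ + 2 * K₁ * P₁ + E₀ * P₂) * z₀ + 2 * (K₁ * P₀ + E₀ * P₁) * z₁ + E₀ * P₀ * z₂))) := by
  set k₀ : ℝ := a₀ + hf * (((q.1 0).val : ℕ) : ℝ) with hk₀
  set k : Fin 2 → ℝ := fun j => hx * (((q.2 j).valMinAbs : ℤ) : ℝ) with hk
  set w : Fin 2 → ℝ := fun j => hx * (u j : ℝ) with hw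
  have hh₀ : 0 ≤ h₀ := (abs_nonneg _).trans (hH0 0)
  have hK10 : 0 ≤ K₁ := le_trans (norm_nonneg _) (hK₁ 0)
  have hK20 : 0 ≤ K₂ := le_trans (norm_nonneg _) (hK₂ 0)
  -- the line factor `W(s) = 2 e v Z (k + s•w)` and the line function
  set W : ℝ → ℝ := fun s => 2 * e (k + s • w) * v (k + s • w) * Z (k + s • w) with hWdef
  have hWC : ContDiff ℝ 2 W :=
    ((contDiff_const.mul (contDiff_two_line he k w)).mul (contDiff_two_line hv k w)).mul (contDiff_two_line hZ k w)
  have hline : (fun s : ℝ => Φ (((k₀, k) : ℝ × (Fin 2 → ℝ)) + s • (((0 : ℝ), w) : ℝ × (Fin 2 → ℝ)))) =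
      fun s => (((H (e (k + s • w) ^ 2 + k₀ ^ 2) * W s : ℝ)) : ℂ) := by
    funext s
    rw [spaceLine_apply, hΦ, add_comm (k₀ ^ 2) (e (k + s • w) ^ 2)]
    simp only [hWdef]
    push_cast
    ring
  have hreal : ContDiff ℝ 2 fun s : ℝ => H (e (k + s • w) ^ 2 + k₀ ^ 2) * W s :=
    (hH.comp (contDiff_two_sq_add (contDiff_two_line he k w) _)).mul hWC
  have hC : ContDiff ℝ 2 fun s : ℝ => Φ (((k₀, k) : ℝ × (Fin 2 → ℝ)) + s • (((0 : ℝ), w) : ℝ × (Fin 2 → ℝ))) := by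
    rw [hline]; exact Complex.ofRealCLM.contDiff.comp hreal
  refine norm_fwdDiff_iter_space_apply_le Φ a₀ hf hx 2 Gs hGs u hzone q hC fun s _ => ?_
  rw [hline, norm_iteratedDeriv_ofReal_comp hreal]
  have h := abs_iteratedDeriv_two_symbol_spaceLine_le (Z := W) he hK₂ hH hWC hΛ hh₁ hh₂ hH0 hH1 hH2 hHv (sq_nonneg k₀) k w s
  obtain ⟨hW0, hW1, hW2⟩ := abs_tripleLine_bounds he hv hZ hE₀ hK₁ hK₂ hP₀ hP₁ hP₂ hz₀ hz₁ hz₂ k w s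
  have hφ1 : |fderiv ℝ e (k + s • w) w| ≤ K₁ * ‖w‖ := by
    rw [← Real.norm_eq_abs]
    exact ((fderiv ℝ e (k + s • w)).le_opNorm w).trans (mul_le_mul_of_nonneg_right (hK₁ _) (norm_nonneg _))
  have hφ1sq : (fderiv ℝ e (k + s • w) w) ^ 2 ≤ (K₁ * ‖w‖) ^ 2 := by
    rw [← sq_abs]; exact pow_le_pow_left₀ (abs_nonneg _) hφ1 2
  have hω0 : 0 ≤ 2 * E₀ * P₀ * z₀ := (abs_nonneg _).trans hW0
  have hω1 : 0 ≤ 2 * ((K₁ * P₀ + E₀ * P₁) * z₀ + E₀ * P₀ * z₁) * ‖w‖ := (abs_nonneg _).trans hW1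
  calc _ ≤ ((4 * h₂ + 2 * h₁) * (fderiv ℝ e (k + s • w) w) ^ 2 / Λ ^ 2 + 2 * h₁ * (K₂ * ‖w‖ ^ 2) / Λ) * |W s| +
        4 * h₁ * |fderiv ℝ e (k + s • w) w| / Λ * |deriv W s| + h₀ * |iteratedDeriv 2 W s| := h
    _ ≤ ((4 * h₂ + 2 * h₁) * (K₁ * ‖w‖) ^ 2 / Λ ^ 2 + 2 * h₁ * (K₂ * ‖w‖ ^ 2) / Λ) * (2 * E₀ * P₀ * z₀) +
        4 * h₁ * (K₁ * ‖w‖) / Λ * (2 * ((K₁ * P₀ + E₀ * P₁) * z₀ + E₀ * P₀ * z₁) * ‖w‖) +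
        h₀ * (2 * ((K₂ * P₀ + 2 * K₁ * P₁ + E₀ * P₂) * z₀ + 2 * (K₁ * P₀ + E₀ * P₁) * z₁ + E₀ * P₀ * z₂) * ‖w‖ ^ 2) := by
        gcongr
    _ = _ := by ring

omit [NeZero L] in
/-- **Time direction, derived symbol**: under the frequency window (`Λ < |a₀ + h_f m|` for `m < 2` and `m ≥ P − 2`),
`‖Δ²_{(1,0)} G̃′(q)‖ ≤ (4h₂ + 2h₁)·h_f²·(2E₀P₀z₀)/Λ²` (p4's `norm_fwdDiff_two_time_sampledSymbol_le` with the derived factor's sup `ω₀`).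
[cite: BenfattoGiulianiMastropietro2006, §2.5 Lemma 2.2 (2.52), (2.56)] -/
theorem norm_fwdDiff_two_time_derivedSymbol_le {H : ℝ → ℝ} (hH : ContDiff ℝ 2 H) {Λ h₁ h₂ : ℝ} (hΛ : 0 < Λ)
    (hh₁ : 0 ≤ h₁) (hh₂ : 0 ≤ h₂) (hH1 : ∀ u, |deriv H u| ≤ h₁ / Λ ^ 2) (hH2 : ∀ u, |iteratedDeriv 2 H u| ≤ h₂ / Λ ^ 4)
    (hHv : ∀ u, Λ ^ 2 < u → H u = 0) (e v Z : (Fin 2 → ℝ) → ℝ)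
    {E₀ P₀ z₀ : ℝ} (hE₀ : ∀ p, |e p| ≤ E₀) (hP₀ : ∀ p, |v p| ≤ P₀) (hz₀ : ∀ p, |Z p| ≤ z₀)
    (Φ : ℝ × (Fin 2 → ℝ) → ℂ) (hΦ : ∀ k₀ p, Φ (k₀, p) = ((H (k₀ ^ 2 + e p ^ 2) * (2 * e p * v p) * Z p : ℝ) : ℂ)) (a₀ hf hx : ℝ)
    (hwin : ∀ m : ℤ, (m < 2 ∨ (P : ℤ) ≤ m + 2) → Λ < |a₀ + hf * (m : ℝ)|)
    (Gs : TorusSite 1 P × TorusSite 2 L → ℂ)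
    (hGs : ∀ q, Gs q = Φ (a₀ + hf * (((q.1 0).val : ℕ) : ℝ), fun j => hx * (((q.2 j).valMinAbs : ℤ) : ℝ)))
    (q : TorusSite 1 P × TorusSite 2 L) :
    ‖((fwdDiff ((fun _ : Fin 1 => (1 : ZMod P)), (0 : TorusSite 2 L)))^[2] Gs) q‖ ≤
      (4 * h₂ + 2 * h₁) * hf ^ 2 * (2 * E₀ * P₀ * z₀) / Λ ^ 2 := by
  have hW0 : ∀ p, |(fun p => 2 * e p * v p * Z p) p| ≤ 2 * E₀ * P₀ * z₀ := by
    intro p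
    have hE0 : 0 ≤ E₀ := (abs_nonneg _).trans (hE₀ p)
    have hP0 : 0 ≤ P₀ := (abs_nonneg _).trans (hP₀ p)
    dsimp only
    rw [abs_mul, abs_mul, abs_mul, abs_two]
    gcongr
    · exact hE₀ p
    · exact hP₀ p
    · exact hz₀ p
  have hΦ' : ∀ k₀ p, Φ (k₀, p) = ((H (k₀ ^ 2 + e p ^ 2) * (fun p => 2 * e p * v p * Z p) p : ℝ) : ℂ) := by
    intro k₀ p; rw [hΦ]; push_cast; ring
  exact norm_fwdDiff_two_time_sampledSymbol_le hH hΛ hh₁ hh₂ hH1 hH2 hHv e (fun p => 2 * e p * v p * Z p) hW0 Φ hΦ' a₀ hf hx hwin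
    Gs hGs q

end Sampled

end Summit.HubbardSuperconductivity.HubbardSuperconductivity.Theorems.TorusFourierL2

end
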